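import Summits.AtomisticToContinuum.FouriersLaw.Theses.HonestZwanzig
import Summits.AtomisticToContinuum.FouriersLaw.Theorems.HonestZwanzigNetworkReductionPackage

/-!
# HonestZwanzig / OrthogonalOhm — the contact identity (stub S3 of line `Sketch`)

Support file for crux `stmt-AtomisticToContinuum-12693` (`OrthogonalOhm` of route `HonestZwanzig`,
sub-problem `FouriersLaw`), line `Sketch`, stub `stub_contactIdentity` (S3). For the canonical objects of
the route at fixed `N ≥ 2` and EVERY Laplace variable `s > 0` (`J = Σ_i j_i`, `j_b` the bond currents,
`p_y²` the kinetic observables, `schur_s` the Schur complement of the split site energies `e_x`):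

  `schur_s(p_y², J) = −Σ_b schur_s(j_b, p_y²)` for every site `y`,

specialised to the two contacts `y = 0` and `y = N − 1`: the contact responses are minus the column
sums of the clamped bond responses.

Proof: time reversal (`lap_rev`; `p_y²` and `e_x` are even in the momenta, the currents odd) gives
`lap_s(p_y², J) = −lap_s(J, p_y²) = −Σ_b lap_s(j_b, p_y²)` (`pkg_J_lap`), `lap_s(p_y², e_x) = lap_s(e_x, p_y²)`
and `lap_s(e_u, J) = −Σ_b lap_s(j_b, e_u)` (`pkg_rev`, `pkg_J_lap`); since `G(s)` is symmetric
(`pkg_G_symm`) so is `G(s)⁻¹` (`Matrix.transpose_nonsing_inv`), and the two Schur complements agree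
after exchanging the two summation indices (pure `Finset` algebra, `circuit_contactIdentity`).
-/

noncomputable section

open MeasureTheory Finset Real Set
open Literature.MathematicalPhysics.KineticTheory.HeatConduction

namespace Summit.AtomisticToContinuum.FouriersLaw.Theorems.HonestZwanzig

namespace OrthogonalOhmLine.stub_contactIdentity

open Matrix NetworkReduction

/-! ### The abstract contact identity (pure circuit algebra at one fixed `s`) -/

section Circuit

variable {X : Type*} {N : ℕ}

/-- **Abstract contact identity.** For abstract pairings `lap, schur` at one fixed `s`, with `schur` the
Schur complement of the observables `e x` through a matrix `G` with symmetric inverse, an observable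
`f` with `lap(f, J) = −Σ_b lap(j_b, f)`, `lap(f, e_x) = lap(e_x, f)` and `lap(e_u, J) = −Σ_b lap(j_b, e_u)`:
`schur(f, J) = −Σ_b schur(j_b, f)`. -/
theorem circuit_contactIdentity (lap schur : (X → ℝ) → (X → ℝ) → ℝ) (e j : Fin N → X → ℝ)
    (f J : X → ℝ) (G : Matrix (Fin N) (Fin N) ℝ)
    (hschur : ∀ f g, schur f g = lap f g - ∑ x, ∑ y, lap f (e x) * G⁻¹ x y * lap (e y) g)
    (hGi : ∀ x y, G⁻¹ x y = G⁻¹ y x)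
    (hfJ : lap f J = -(∑ b, lap (j b) f))
    (hfe : ∀ x, lap f (e x) = lap (e x) f)
    (heJ : ∀ u, lap (e u) J = -(∑ b, lap (j b) (e u))) :
    schur f J = -(∑ b, schur (j b) f) := by
  -- exchange the two summation indices in the clamped bond responses
  have key : ∀ b, ∑ x, ∑ u, lap (j b) (e x) * G⁻¹ x u * lap (e u) f =
      ∑ x, ∑ u, lap (e x) f * G⁻¹ x u * lap (j b) (e u) := by
    intro b
    rw [Finset.sum_comm]
    refine Finset.sum_congr rfl fun x _ => Finset.sum_congr rfl fun u _ => ?_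
    rw [hGi u x]
    ring
  -- collect the bond sum innermost
  have hc : ∑ b, ∑ x, ∑ u, lap (e x) f * G⁻¹ x u * lap (j b) (e u) =
      ∑ x, ∑ u, lap (e x) f * G⁻¹ x u * ∑ b, lap (j b) (e u) := by
    rw [Finset.sum_comm]
    refine Finset.sum_congr rfl fun x _ => ?_
    rw [Finset.sum_comm]
    refine Finset.sum_congr rfl fun u _ => ?_
    rw [Finset.mul_sum]
  simp only [hschur, hfJ, hfe, heJ, key]
  rw [Finset.sum_sub_distrib, hc]
  simp only [mul_neg, Finset.sum_neg_distrib]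
  ring

end Circuit

/-! ### The contact identity for the canonical objects of the route -/

section Package

variable {ω₂ lam β γ : ℝ} {N : ℕ} {T : ℝ}
  {Adm : (PhaseSpace N → ℝ) → Prop}
  {corr : (PhaseSpace N → ℝ) → (PhaseSpace N → ℝ) → ℝ → ℝ}
  {lap : ℝ → (PhaseSpace N → ℝ) → (PhaseSpace N → ℝ) → ℝ}
  {cov : (PhaseSpace N → ℝ) → (PhaseSpace N → ℝ) → ℝ}
  {e : Fin N → PhaseSpace N → ℝ}
  (hAdm : ∀ f, Adm f ↔ (Continuous f ∧ ∃ A : ℝ, ∀ z,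
    |f z| ≤ A * Real.exp ((pinnedChain ω₂ lam β γ).hamiltonian N z / (8 * T))))
  (hcorr : ∀ f g t, corr f g t =
    (∫ z, f z * (∫ y, g y ∂((pinnedChain ω₂ lam β γ).transitionKernel N T T t.toNNReal z))
      ∂(pinnedChain ω₂ lam β γ).gibbsMeasure N T) -
    (∫ z, f z ∂(pinnedChain ω₂ lam β γ).gibbsMeasure N T) *
      (∫ z, g z ∂(pinnedChain ω₂ lam β γ).gibbsMeasure N T))
  (hlap : ∀ s f g, lap s f g = ∫ t in Set.Ioi (0 : ℝ), Real.exp (-(s * t)) * corr f g t)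
  (he : ∀ x z, e x z = z.2 x ^ 2 / 2 + (pinnedChain ω₂ lam β γ).U (z.1 x) +
    ∑ j : Fin N, ((if j.val = x.val + 1 then (pinnedChain ω₂ lam β γ).V (z.1 j - z.1 x) / 2 else 0) +
      (if x.val = j.val + 1 then (pinnedChain ω₂ lam β γ).V (z.1 x - z.1 j) / 2 else 0)))
  (hFI : ∀ f g : PhaseSpace N → ℝ, Adm f → Adm g →
    Integrable f ((pinnedChain ω₂ lam β γ).gibbsMeasure N T) ∧
    (∀ t : ℝ, 0 ≤ t → Integrable (fun z => f z *
      (∫ y, g y ∂((pinnedChain ω₂ lam β γ).transitionKernel N T T t.toNNReal z)))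
      ((pinnedChain ω₂ lam β γ).gibbsMeasure N T)) ∧
    IntegrableOn (corr f g) (Set.Ioi 0) ∧
    (∀ t : ℝ, 0 ≤ t → corr f g t = corr (fun z => g (z.1, -z.2)) (fun z => f (z.1, -z.2)) t) ∧
    (∀ s : ℝ, 0 < s → ∀ x : Fin N,
      s * lap s (e x) g - cov (e x) g =
        lap s (fun z => (pinnedChain ω₂ lam β γ).generator N T T (e x) (z.1, -z.2)) g ∧
      s * lap s f (e x) - cov f (e x) = lap s f ((pinnedChain ω₂ lam β γ).generator N T T (e x))))
  (hω : 0 < ω₂) (hl : 0 ≤ lam) (hβ : 0 ≤ β) (hT : 0 < T)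

include hAdm hcorr hlap hFI hω hl hβ hT in
/-- Time reversal of the kinetic observable against the current:
`lap_s(p_y², J) = −Σ_b lap_s(j_b, p_y²)` (`p_y²` even, `J` odd in the momenta; `pkg_J_lap`). -/
theorem pkg_psq_J {s : ℝ} (hs : 0 ≤ s) (y : Fin N) :
    lap s (fun z => z.2 y ^ 2) (fun z => ∑ i : Fin N, (pinnedChain ω₂ lam β γ).bondCurrent N i z) =
      -(∑ b, lap s ((pinnedChain ω₂ lam β γ).bondCurrent N b) (fun z => z.2 y ^ 2)) := by
  have hp : Adm (fun z : PhaseSpace N => z.2 y ^ 2) := adm_psq Adm hAdm hω hl hβ hT y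
  rw [lap_rev hlap hFI hp (adm_totalCurrent Adm hAdm hω hl hβ hT) s]
  have h1 : (fun z : PhaseSpace N => ∑ i : Fin N, (pinnedChain ω₂ lam β γ).bondCurrent N i (z.1, -z.2)) =
      fun z => (-1) * ∑ i : Fin N, (pinnedChain ω₂ lam β γ).bondCurrent N i z := by
    funext z
    rw [neg_one_mul, ← Finset.sum_neg_distrib]
    exact Finset.sum_congr rfl fun i _ => OscillatorChain.bondCurrent_neg_momentum _ N i z
  have h2 : (fun z : PhaseSpace N => (z.1, -z.2).2 y ^ 2) = fun z => z.2 y ^ 2 := by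
    funext z
    simp only [Pi.neg_apply, neg_sq]
  rw [h1, h2, lap_const_mul_left hcorr hlap, pkg_J_lap hAdm hcorr hlap hFI hω hl hβ hT hs hp, neg_one_mul]

include hAdm hlap hFI he hω hl hβ hT in
/-- Time reversal of the kinetic observable against a site energy (both even in the momenta):
`lap_s(p_y², e_x) = lap_s(e_x, p_y²)`. -/
theorem pkg_psq_e (s : ℝ) (y x : Fin N) :
    lap s (fun z => z.2 y ^ 2) (e x) = lap s (e x) (fun z => z.2 y ^ 2) := by
  rw [lap_rev hlap hFI (adm_psq Adm hAdm hω hl hβ hT y) (adm_e Adm hAdm e he hω hl hβ hT x) s]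
  have h1 : (fun z : PhaseSpace N => e x (z.1, -z.2)) = e x := funext fun z => e_neg_momentum _ e he x z
  have h2 : (fun z : PhaseSpace N => (z.1, -z.2).2 y ^ 2) = fun z => z.2 y ^ 2 := by
    funext z
    simp only [Pi.neg_apply, neg_sq]
  rw [h1, h2]

include hAdm hcorr hlap hFI he hω hl hβ hT in
/-- `lap_s(e_u, J) = −Σ_b lap_s(j_b, e_u)` (`pkg_rev` and `pkg_J_lap`). -/
theorem pkg_e_J {s : ℝ} (hs : 0 ≤ s) (u : Fin N) :
    lap s (e u) (fun z => ∑ i : Fin N, (pinnedChain ω₂ lam β γ).bondCurrent N i z) =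
      -(∑ b, lap s ((pinnedChain ω₂ lam β γ).bondCurrent N b) (e u)) := by
  rw [pkg_rev hAdm hcorr hlap he hFI hω hl hβ hT s u,
    pkg_J_lap hAdm hcorr hlap hFI hω hl hβ hT hs (adm_e Adm hAdm e he hω hl hβ hT u)]

include hAdm hcorr hlap hFI he hω hl hβ hT in
/-- **The contact identity for the canonical objects** at fixed `N`, fixed `s > 0` and every site `y`:
`schur_s(p_y², J) = −Σ_b schur_s(j_b, p_y²)`. -/
theorem pkg_contactIdentity {s : ℝ} (hs : 0 < s)
    (G : Matrix (Fin N) (Fin N) ℝ) (hG : ∀ x y, G x y = lap s (e x) (e y))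
    (schur : (PhaseSpace N → ℝ) → (PhaseSpace N → ℝ) → ℝ)
    (hschur : ∀ f g, schur f g = lap s f g - ∑ x, ∑ y, lap s f (e x) * G⁻¹ x y * lap s (e y) g)
    (y : Fin N) :
    schur (fun z => z.2 y ^ 2) (fun z => ∑ i : Fin N, (pinnedChain ω₂ lam β γ).bondCurrent N i z) =
      -(∑ b : Fin N, schur ((pinnedChain ω₂ lam β γ).bondCurrent N b) (fun z => z.2 y ^ 2)) := by
  -- `G(s)` is symmetric, hence so is `G(s)⁻¹`
  have hGsym : ∀ x y, G x y = G y x := fun x y => by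
    rw [hG, hG, pkg_G_symm hAdm hlap he hFI hω hl hβ hT s]
  have hGT : G⁻¹ᵀ = G⁻¹ := by
    rw [Matrix.transpose_nonsing_inv, transpose_eq_of_symm G hGsym]
  have hGi : ∀ x y, G⁻¹ x y = G⁻¹ y x := fun x y =>
    (Matrix.transpose_apply G⁻¹ y x).symm.trans (congrFun (congrFun hGT y) x)
  exact circuit_contactIdentity (lap s) schur e ((pinnedChain ω₂ lam β γ).bondCurrent N)
    (fun z => z.2 y ^ 2) (fun z => ∑ i : Fin N, (pinnedChain ω₂ lam β γ).bondCurrent N i z) G hschur hGi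
    (pkg_psq_J hAdm hcorr hlap hFI hω hl hβ hT hs.le y) (pkg_psq_e hAdm hlap he hFI hω hl hβ hT s y)
    (pkg_e_J hAdm hcorr hlap he hFI hω hl hβ hT hs.le)

end Package

end OrthogonalOhmLine.stub_contactIdentity

/-! ### The registered stub -/

/-- **Stub S3** (`ContactIdentity`, fixed `N`, every `s > 0`; line `Sketch` of crux `OrthogonalOhm`): the contact
responses are minus the column sums of the clamped bond responses,
`schur_s(p_0², J) = −Σ_b schur_s(j_b, p_0²)` and `schur_s(p²_{N−1}, J) = −Σ_b schur_s(j_b, p²_{N−1})` — time reversal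
(`lap_rev`: `p²` and `e_x` even, currents odd), `lap_s(J, ·) = Σ_b lap_s(j_b, ·)` (`pkg_J_lap`), `pkg_rev`, and the
symmetry of `G(s)⁻¹` (`pkg_G_symm`, `Matrix.transpose_nonsing_inv`); from the route item `FeshbachIdentities`. -/
theorem stub_contactIdentity : Summit.AtomisticToContinuum.FouriersLaw.Theses.HonestZwanzig.FeshbachIdentities →
    ∀ ω₂ lam β γ : ℝ, 0 < ω₂ → 0 < lam → 0 < β → 0 < γ → ∀ T : ℝ, 0 < T → ∀ N : ℕ, ∀ hN : 2 ≤ N, let P := Literature.MathematicalPhysics.KineticTheory.HeatConduction.pinnedChain ω₂ lam β γ; let X := Literature.MathematicalPhysics.KineticTheory.HeatConduction.PhaseSpace N; let μ : MeasureTheory.Measure X := P.gibbsMeasure N T; let corr : (X → ℝ) → (X → ℝ) → ℝ → ℝ := fun f g t => (∫ z, f z * (∫ y, g y ∂(P.transitionKernel N T T t.toNNReal z)) ∂μ) - (∫ z, f z ∂μ) * (∫ z, g z ∂μ); let lap : ℝ → (X → ℝ) → (X → ℝ) → ℝ := fun s f g => ∫ t in Set.Ioi (0 : ℝ), Real.exp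 (-(s * t)) * corr f g t; let e : Fin N → X → ℝ := fun x z => z.2 x ^ 2 / 2 + P.U (z.1 x) + ∑ j : Fin N, ((if j.val = x.val + 1 then P.V (z.1 j - z.1 x) / 2 else 0) + (if x.val = j.val + 1 then P.V (z.1 x - z.1 j) / 2 else 0)); let G : ℝ → Matrix (Fin N) (Fin N) ℝ := fun s => Matrix.of fun x y => lap s (e x) (e y); let schur : ℝ → (X → ℝ) → (X → ℝ) → ℝ := fun s f g => lap s f g - ∑ x : Fin N, ∑ y : Fin N, lap s f (e x) * (G s)⁻¹ x y * lap s (e y) g; let J : X → ℝ := fun z => ∑ i : Fin N, P.bondCurrent N i z; ∀ s : ℝ, 0 < s →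
      schur s (fun z => z.2 ⟨0, by omega⟩ ^ 2) J =
          -(∑ b : Fin N, schur s (P.bondCurrent N b) (fun z => z.2 ⟨0, by omega⟩ ^ 2)) ∧
        schur s (fun z => z.2 ⟨N - 1, by omega⟩ ^ 2) J =
          -(∑ b : Fin N, schur s (P.bondCurrent N b) (fun z => z.2 ⟨N - 1, by omega⟩ ^ 2)) := by
  intro hFI ω₂ lam β γ hω hl hβ hγ T hT N hN P X μ corr lap e G schur J s hs
  obtain ⟨-, hFI2, -, -⟩ := hFI ω₂ lam β γ hω hl hβ hγ T hT N hN
  exact ⟨OrthogonalOhmLine.stub_contactIdentity.pkg_contactIdentity (ω₂ := ω₂) (lam := lam) (β := β)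
      (γ := γ) (N := N) (T := T) (corr := corr) (lap := lap)
      (cov := fun f g => (∫ z, f z * g z ∂μ) - (∫ z, f z ∂μ) * (∫ z, g z ∂μ)) (e := e)
      (fun f => Iff.rfl) (fun f g t => rfl) (fun s f g => rfl) (fun x z => rfl) hFI2 hω hl.le hβ.le hT hs
      (G s) (fun x y => rfl) (schur s) (fun f g => rfl) ⟨0, by omega⟩,
    OrthogonalOhmLine.stub_contactIdentity.pkg_contactIdentity (ω₂ := ω₂) (lam := lam) (β := β)
      (γ := γ) (N := N) (T := T) (corr := corr) (lap := lap)
      (cov := fun f g => (∫ z, f z * g z ∂μ) - (∫ z, f z ∂μ) * (∫ z, g z ∂μ)) (e := e)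
      (fun f => Iff.rfl) (fun f g t => rfl) (fun s f g => rfl) (fun x z => rfl) hFI2 hω hl.le hβ.le hT hs
      (G s) (fun x y => rfl) (schur s) (fun f g => rfl) ⟨N - 1, by omega⟩⟩

end Summit.AtomisticToContinuum.FouriersLaw.Theorems.HonestZwanzig

end
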